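import Literature.MathematicalPhysics.QuantumFieldTheory.Balaban1983to89.B2Eq328ConcretePieces
import Literature.MathematicalPhysics.QuantumFieldTheory.Balaban1983to89.B1Eq230FluctCov

/-!
# `Balaban1983to89.B2Eq328DeltaK` — [Balaban1982Higgs2] (3.28) p. 589 with the operators of [Balaban1982Higgs1] (2.21): the
per-scale form `⟨φ_k, Δ^{(k),Lᵏε}(Bᵏ(Λ_k), Ã^ε)φ_k⟩` of file `B2Eq328ConcretePieces` (there: the fibre minimum `termForm` of the
(I.2.19) exponent, = the form in the exponent of the renormalization transformation by `eq219_piece`) IS the quadratic form of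
the SOLVED operator (I.2.21) `Δ^{(k),Lᵏε}(Ω,Ã) = a_k(Lᵏε)^{−2}·1 − a_k²(Lᵏε)^{−4}·Q_k(Ã)G^ε_k(Ω,Ã)Q^*_k(Ã)` of the tree
(`B1Eq230FluctCov.deltaKA`, general `Ã`, `Ω = Bᵏ(Λ_k)`) — *"calculating the integral in (2.19), we obtain (2.21)"* PROVED for
the concrete Neumann operators on a union of blocks, by completing the square on the whole torus (minimiser = the background
field (I.3.29) `a_k(Lᵏε)^{−2}G^ε_kQ^*_kψ`)

statement-level skeleton of published theorems with citation tags; proofs where landed; nothing here is a claim about the Yang–Mills mass gap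

CITATION HEADER.  T. Bałaban, *(Higgs)₂,₃ quantum fields in a finite volume. II. An upper bound*, Commun. Math. Phys. **86**
(1982) 555–594 [Balaban1982Higgs2], (3.28) p. 589; *I. A lower bound*, Commun. Math. Phys. **85** (1982) 603–626
[Balaban1982Higgs1], (2.19)–(2.21) p. 610 and (3.29) p. 617 (PDFs held `paper:balaban1982-cmp86-higgs23-ii`,
`paper:balaban1982-cmp85-higgs23-i`; pages READ AS IMAGES on the ×2 renders under
`run/shared/lean/pub/pub-balaban/b2b-balaban-ref1/pages/`).  Unit `lit-balaban-p15` gen 4, target 2, file 3 (Phase-2 proof seat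
p15; HOME `run/shared/lean/pub/lit-balaban/`).  SKELETON rows **B2.Eq3.29** (member (3.28); owner r02) and **B1.Eq2.17/B1.Eq2.21**
(owner r14; (2.19) → (2.21) was COMPUTED in matrix coordinates by p34's `B1Eq221Dictionary.display219`/`coordSchur_eq` and the
concrete operators are p35's `B1Eq230FluctCov` — here the coordinate-free variational statement for the concrete Neumann
operators on a region that is a union of k-blocks; no decl of record is restated).

WHAT IS PRINTED.  [Balaban1982Higgs1] p. 610: *"Defining the propagator G^ε_k(Ω,A) = (−Δ^{ε,N}_{A,Ω} + m² +
a_k(Lᵏε)^{−2}P_k(A))^{−1}, P_k(A) = Q^*_k(A)Q_k(A), (2.20) and calculating the integral in (2.19), we obtain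
⟨ψ,Δ^{(k),Lᵏε}(Ω,A)ψ⟩ = a_k(Lᵏε)^{−2}⟨ψ,ψ⟩ − a_k²(Lᵏε)^{−4}⟨ψ,Q_k(A)G^ε_k(Ω,A)Q^*_k(A)ψ⟩. (2.21)"*; p. 617: *"φ^{(k),ε} =
a_k(Lᵏε)^{−2}G^ε_k(A^{(k),ε})Q^*_k(A^{(k),ε})φ (3.29)"*; [Balaban1982Higgs2] p. 589: (3.28) (quoted in `B2Eq328ConcretePieces`).

WHAT THIS MODULE PROVES (kernel-checked, 0 `sorry`, standard axioms; every `Ã`, `m² > 0`, `a > 0`, `L > 1`).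
 §1 ON THE WHOLE TORUS, any `Ω ⊂ T_ε`, any `ψ̃ : T⁽ᵏ⁾ → ℝ^N`, `k ≥ 1`: the (I.2.19) exponent `wholeExp` =
    `a_k(Lᵏε)^{−2}⟨ψ̃ − Q_k(Ã)φ, ψ̃ − Q_k(Ã)φ⟩_{T⁽ᵏ⁾} + ⟨φ, (−Δ^{ε,N}_{Ã,Ω}+m²)φ⟩_{T_ε}`; **`wholeExp_eq`** (completing the square with
    the tree's `covOpK`/`propagatorK`: `wholeExp ψ̃ φ = ⟨φ−φ₀,(G^ε_k)^{−1}(φ−φ₀)⟩ + ⟨ψ̃, Δ^{(k)}(Ω,Ã)ψ̃⟩`, `φ₀ = bgField` = (I.3.29));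
    **`iInf_wholeExp`**: `⨅_φ wholeExp ψ̃ φ = ⟨ψ̃, deltaKA … k ψ̃⟩` (= (I.2.21) as the value of the Gaussian exponent's minimum).
 §2 ON THE PIECE `Ω = Bᵏ(Λ_k)` (`k = j + 1`, `ψ̃ = extL ψ` the extension by zero of `ψ : Λ_k → ℝ^N`): `wholeExp (extL ψ) (extP v)
    = pieceExp ψ v` and `pieceExp ψ (φ↾_Ω) ≤ wholeExp (extL ψ) φ` (sites of `T⁽ᵏ⁾ ∖ Λ_k` and of `T_ε ∖ Ω` only add non-negative
    terms: `Q_k` of a field supported off `Ω` vanishes on `Λ_k` and conversely), hence **`termForm_eq_deltaKA`**: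
    `termForm R C a Ã m² j ψ = ⟨extL ψ, deltaKA C (Bᵏ(Λ_k)) Ã m² a k (extL ψ)⟩_{T⁽ᵏ⁾}`.
 §3 **`eq328_deltaKA`**: (3.28) with the (I.2.21) operators — `⟨Φ, Δ′(Ã^ε)Φ⟩ = ⟨φ₀,(−Δ^{ε,N}_{Ã,Λ₅⁽⁰⁾ᶜ}+m²)φ₀⟩ +
    Σ_{k=1}^{K} ⟨φ_k, Δ^{(k),Lᵏε}(Bᵏ(Λ_k), Ã^ε)φ_k⟩`.
HONEST SCOPE.  The hypothesis `Nested R` of `B2Eq328ConcretePieces` (Λ₅⁽⁰⁾ = ⨆_k Bᵏ(Λ_k)) is kept; nothing quantitative about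
`Δ^{(k)}` (Props. I.2.1–I.2.3, (3.29) of paper II) is touched.
-/

noncomputable section

open MeasureTheory Finset Real
open scoped BigOperators ENNReal InnerProductSpace

namespace Literature.MathematicalPhysics.QuantumFieldTheory.Balaban1983to89.B2Eq328DeltaK

open Literature.MathematicalPhysics.QuantumFieldTheory.Balaban1983to89.HiggsLattice
open Literature.MathematicalPhysics.QuantumFieldTheory.Balaban1983to89.HiggsAveraging
open Literature.MathematicalPhysics.QuantumFieldTheory.Balaban1983to89.HiggsCovariance
open Literature.MathematicalPhysics.QuantumFieldTheory.Balaban1983to89.HiggsCovariancePos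
open Literature.MathematicalPhysics.QuantumFieldTheory.Balaban1983to89.HiggsFluctMeasure
open Literature.MathematicalPhysics.QuantumFieldTheory.Balaban1983to89.B1Eq230FluctCov
open Literature.MathematicalPhysics.QuantumFieldTheory.Balaban1983to89.B2Ineq338Diamagnetic
open Literature.MathematicalPhysics.QuantumFieldTheory.Balaban1983to89.B2Eq337ScalarIntegration
open Literature.MathematicalPhysics.QuantumFieldTheory.Balaban1983to89.B2Eq325ConcreteSchur
open Literature.MathematicalPhysics.QuantumFieldTheory.Balaban1983to89.B2Ineq327ConcreteNeumann
open Literature.MathematicalPhysics.QuantumFieldTheory.Balaban1983to89.B2Eq328ConcretePieces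

variable {P : HiggsLattice.Params} {N K : ℕ}

/-! ## §1 The (I.2.19) exponent on the whole torus and its minimum: (I.2.21) by completing the square -/

section Whole

variable (C : ChargeData N) (Ω : Finset (HiggsLattice.Site P 0)) (A : HiggsLattice.VecField P 0) (msq a : ℝ) (k : ℕ)

/-- Twice (minus) the exponent of (I.2.19) with the integration variable on the whole torus:
`a_k(Lᵏε)^{−2}⟨ψ̃ − Q_k(Ã)φ, ψ̃ − Q_k(Ã)φ⟩_{T⁽ᵏ⁾} + ⟨φ, (−Δ^{ε,N}_{Ã,Ω} + m²)φ⟩_{T_ε}` (the kernel constant `a_k(Lᵏε)^{d−2}` of (I.2.10)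
is `a_k(Lᵏε)^{−2}` times the weight `(Lᵏε)^d` of `⟨·,·⟩_{T⁽ᵏ⁾}`). [cite: Balaban1982Higgs1, (2.19) p.610] -/
def wholeExp (ψt : ScalarField P k N) (φ : ScalarField P 0 N) : ℝ :=
  coeff221 P a k * siteInner (ψt - avgQkLin C A k φ) (ψt - avgQkLin C A k φ) + siteInner φ (delta0 C Ω A msq φ)

/-- **The background field (I.3.29)**: `φ₀ = a_k(Lᵏε)^{−2} G^ε_k(Ω,Ã) Q^*_k(Ã) ψ̃` — the minimiser of the (I.2.19) exponent.
[cite: Balaban1982Higgs1, (3.29) p.617] -/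
def bgField (ψt : ScalarField P k N) : ScalarField P 0 N :=
  propagatorK C Ω A msq a k (coeff221 P a k • avgQkAdj C A k ψt)

/-- `⟨f, (G^ε_k)^{−1} g⟩ = ⟨f, (−Δ^{ε,N}_{Ã,Ω}+m²)g⟩ + a_k(Lᵏε)^{−2}⟨Q_k f, Q_k g⟩_{T⁽ᵏ⁾}` ((I.2.20), adjointness of `Q^*_k`).
[cite: Balaban1982Higgs1, (2.20) p.610] -/
theorem siteInner_covOpK_eq (f g : ScalarField P 0 N) :
    siteInner f (covOpK C Ω A msq a k g)
      = siteInner f (delta0 C Ω A msq g) + coeff221 P a k * siteInner (avgQkLin C A k f) (avgQkLin C A k g) := by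
  have h1 : covOpK C Ω A msq a k g = delta0 C Ω A msq g + coeff221 P a k • projPk C A k g := rfl
  have h2 : siteInner f (projPk C A k g) = siteInner (avgQkLin C A k f) (avgQkLin C A k g) := by
    rw [projPk, LinearMap.comp_apply, ← siteInner_avgQkLin]
  rw [h1, ← siteBilin_apply, map_add, map_smul, siteBilin_apply, siteBilin_apply, smul_eq_mul, h2]

/-- The operator `(G^ε_k)^{−1}` of (I.2.20) is symmetric for (1.5). [cite: Balaban1982Higgs1, (2.20) p.610] -/
theorem siteInner_covOpK_comm (f g : ScalarField P 0 N) :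
    siteInner f (covOpK C Ω A msq a k g) = siteInner g (covOpK C Ω A msq a k f) := by
  rw [siteInner_covOpK_eq, siteInner_covOpK_eq, siteInner_delta0_comm, siteInner_symm' (avgQkLin C A k f)]

variable {msq a k}

/-- `(G^ε_k)^{−1} φ₀ = a_k(Lᵏε)^{−2} Q^*_k ψ̃`: the background field solves the stationarity equation (`m² > 0`, `a_k ≥ 0`).
[cite: Balaban1982Higgs1, (3.29) p.617] -/
theorem covOpK_bgField (hmsq : 0 < msq) (hak : 0 ≤ B1.aSeq a P.L k) (ψt : ScalarField P k N) :
    covOpK C Ω A msq a k (bgField C Ω A msq a k ψt) = coeff221 P a k • avgQkAdj C A k ψt := by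
  unfold bgField
  exact covOpK_propagatorK_apply C Ω A hmsq a k hak _

/-- **Completing the square on the whole torus**: `wholeExp ψ̃ φ = ⟨φ − φ₀, (G^ε_k)^{−1}(φ − φ₀)⟩ + ⟨ψ̃, Δ^{(k),Lᵏε}(Ω,Ã)ψ̃⟩` with
`φ₀ = bgField` and `Δ^{(k)}` the SOLVED operator (I.2.21) (`B1Eq230FluctCov.deltaKA`, `k = j + 1 ≥ 1`).
[cite: Balaban1982Higgs1, (2.19)–(2.21) p.610] -/
theorem wholeExp_eq (j : ℕ) (hmsq : 0 < msq) (hak : 0 ≤ B1.aSeq a P.L (j + 1)) (ψt : ScalarField P (j + 1) N)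
    (φ : ScalarField P 0 N) :
    wholeExp C Ω A msq a (j + 1) ψt φ
      = siteInner (φ - bgField C Ω A msq a (j + 1) ψt) (covOpK C Ω A msq a (j + 1) (φ - bgField C Ω A msq a (j + 1) ψt))
        + siteInner ψt (deltaKA C Ω A msq a (j + 1) ψt) := by
  -- bilinearity bookkeeping for the scalar products (1.5)
  have hB : ∀ f g h : ScalarField P 0 N, siteInner (f - g) h = siteInner f h - siteInner g h := fun f g h => by
    rw [← siteBilin_apply, LinearMap.map_sub₂, siteBilin_apply, siteBilin_apply]
  have hB' : ∀ f g h : ScalarField P 0 N, siteInner f (g - h) = siteInner f g - siteInner f h := fun f g h => by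
    rw [← siteBilin_apply, map_sub, siteBilin_apply, siteBilin_apply]
  have hS : ∀ (c : ℝ) (f g : ScalarField P 0 N), siteInner f (c • g) = c * siteInner f g := fun c f g => by
    rw [← siteBilin_apply, map_smul, siteBilin_apply, smul_eq_mul]
  have hBk : ∀ f g h : ScalarField P (j + 1) N, siteInner (f - g) h = siteInner f h - siteInner g h := fun f g h => by
    rw [← siteBilin_apply, LinearMap.map_sub₂, siteBilin_apply, siteBilin_apply]
  have hBk' : ∀ f g h : ScalarField P (j + 1) N, siteInner f (g - h) = siteInner f g - siteInner f h := fun f g h => by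
    rw [← siteBilin_apply, map_sub, siteBilin_apply, siteBilin_apply]
  have hSk : ∀ (c : ℝ) (f g : ScalarField P (j + 1) N), siteInner f (c • g) = c * siteInner f g := fun c f g => by
    rw [← siteBilin_apply, map_smul, siteBilin_apply, smul_eq_mul]
  have hSk' : ∀ (c : ℝ) (f g : ScalarField P (j + 1) N), siteInner (c • f) g = c * siteInner f g := fun c f g => by
    rw [← siteBilin_apply, LinearMap.map_smul₂, siteBilin_apply, smul_eq_mul]
  set κ : ℝ := coeff221 P a (j + 1) with hκ
  set φ₀ : ScalarField P 0 N := bgField C Ω A msq a (j + 1) ψt with hφ₀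
  have hMφ₀ : covOpK C Ω A msq a (j + 1) φ₀ = κ • avgQkAdj C A (j + 1) ψt := covOpK_bgField C Ω A hmsq hak ψt
  have hsymm := siteInner_covOpK_comm C Ω A msq a (j + 1)
  -- (1) the kernel term expanded
  have e1 : siteInner (ψt - avgQkLin C A (j + 1) φ) (ψt - avgQkLin C A (j + 1) φ)
      = siteInner ψt ψt - 2 * siteInner φ (avgQkAdj C A (j + 1) ψt)
        + siteInner (avgQkLin C A (j + 1) φ) (avgQkLin C A (j + 1) φ) := by
    rw [hBk, hBk', hBk', siteInner_symm' ψt (avgQkLin C A (j + 1) φ), siteInner_avgQkLin C A (j + 1) φ ψt]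
    ring
  -- (2) ⟨Q φ₀, ψ̃⟩ = κ⟨ψ̃, Q G Q^* ψ̃⟩
  have e2 : siteInner φ₀ (avgQkAdj C A (j + 1) ψt)
      = κ * siteInner ψt (avgQkLin C A (j + 1) (propagatorK C Ω A msq a (j + 1) (avgQkAdj C A (j + 1) ψt))) := by
    rw [← siteInner_avgQkLin C A (j + 1) φ₀ ψt, hφ₀, bgField, map_smul, map_smul, hSk',
      siteInner_symm' _ ψt]
  -- (3) the completed square expanded
  have e3 : siteInner (φ - φ₀) (covOpK C Ω A msq a (j + 1) (φ - φ₀))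
      = (siteInner φ (delta0 C Ω A msq φ) + κ * siteInner (avgQkLin C A (j + 1) φ) (avgQkLin C A (j + 1) φ))
        - 2 * (κ * siteInner φ (avgQkAdj C A (j + 1) ψt))
        + κ * (κ * siteInner ψt (avgQkLin C A (j + 1)
            (propagatorK C Ω A msq a (j + 1) (avgQkAdj C A (j + 1) ψt)))) := by
    rw [map_sub, hB, hB', hB', hsymm φ₀ φ, hMφ₀, hS κ φ, hS κ φ₀, e2, siteInner_covOpK_eq, ← hκ]
    ring
  -- (4) the solved form (I.2.21)
  have e4 : siteInner ψt (deltaKA C Ω A msq a (j + 1) ψt)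
      = κ * siteInner ψt ψt - κ ^ 2 * siteInner ψt (avgQkLin C A (j + 1)
          (propagatorK C Ω A msq a (j + 1) (avgQkAdj C A (j + 1) ψt))) := by
    rw [deltaKA_succ, LinearMap.sub_apply, hBk', LinearMap.smul_apply, LinearMap.smul_apply, hSk, hSk,
      LinearMap.id_apply, LinearMap.comp_apply, LinearMap.comp_apply, ← hκ]
  unfold wholeExp
  rw [← hκ, e1, e3, e4]
  ring

/-- `(G^ε_k)^{−1} ≥ m² ≥ 0`: the completed square is non-negative. [cite: Balaban1982Higgs1, (2.20) p.610] -/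
theorem siteInner_covOpK_nonneg (hmsq : 0 ≤ msq) (hak : 0 ≤ B1.aSeq a P.L k) (χ : ScalarField P 0 N) :
    0 ≤ siteInner χ (covOpK C Ω A msq a k χ) :=
  le_trans (mul_nonneg hmsq (siteInner_self_nonneg χ)) (siteInner_covOpK_ge C Ω A msq a k hak χ)

/-- The minimum is attained at the background field: `wholeExp ψ̃ φ₀ = ⟨ψ̃, Δ^{(k)}ψ̃⟩`. [cite: Balaban1982Higgs1, (3.29) p.617] -/
theorem wholeExp_bgField (j : ℕ) (hmsq : 0 < msq) (hak : 0 ≤ B1.aSeq a P.L (j + 1)) (ψt : ScalarField P (j + 1) N) :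
    wholeExp C Ω A msq a (j + 1) ψt (bgField C Ω A msq a (j + 1) ψt)
      = siteInner ψt (deltaKA C Ω A msq a (j + 1) ψt) := by
  rw [wholeExp_eq C Ω A j hmsq hak, sub_self, map_zero]
  simp [siteInner]

/-- **(I.2.21) as the minimum of the (I.2.19) exponent**: `⨅_φ wholeExp ψ̃ φ = ⟨ψ̃, Δ^{(k),Lᵏε}(Ω,Ã)ψ̃⟩`, attained at the
background field (I.3.29). [cite: Balaban1982Higgs1, (2.21) p.610] -/
theorem iInf_wholeExp (j : ℕ) (hmsq : 0 < msq) (hak : 0 ≤ B1.aSeq a P.L (j + 1)) (ψt : ScalarField P (j + 1) N) :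
    (⨅ φ : ScalarField P 0 N, wholeExp C Ω A msq a (j + 1) ψt φ)
      = siteInner ψt (deltaKA C Ω A msq a (j + 1) ψt) := by
  have hge : ∀ φ, siteInner ψt (deltaKA C Ω A msq a (j + 1) ψt) ≤ wholeExp C Ω A msq a (j + 1) ψt φ := fun φ => by
    rw [wholeExp_eq C Ω A j hmsq hak]
    linarith [siteInner_covOpK_nonneg C Ω A hmsq.le hak (φ - bgField C Ω A msq a (j + 1) ψt)]
  refine le_antisymm ?_ (le_ciInf hge)
  exact le_trans (ciInf_le ⟨_, by rintro _ ⟨φ, rfl⟩; exact hge φ⟩ (bgField C Ω A msq a (j + 1) ψt))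
    (le_of_eq (wholeExp_bgField C Ω A j hmsq hak ψt))

end Whole

/-! ## §2 On the piece `Ω = Bᵏ(Λ_k)`: the whole-torus minimum is the piece minimum `termForm` -/

section Piece

variable (R : Regions P K) (C : ChargeData N) (a : ℝ) (A : HiggsLattice.VecField P 0) (msq : ℝ)

/-- Extension by zero of `ψ : Λ_k → ℝ^N` to `T⁽ᵏ⁾` (`k = j + 1`). [cite: Balaban1982Higgs2, (3.24) p.588] -/
def extL (j : Fin K) (ψ : LSite R j → V N) : ScalarField P (j.val + 1) N :=
  fun y => if h : y ∈ R.block j then ψ ⟨y, h⟩ else 0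

/-- Restriction of a field on `T_ε` to the piece. [cite: Balaban1982Higgs1, (2.17) p.610] -/
def resΩ (j : Fin K) (φ : ScalarField P 0 N) : PSite R j → V N := fun x => φ x.val

/-- `a_k(Lᵏε)^{d−2} = a_k(Lᵏε)^{−2}·(Lᵏε)^d`: the kernel constant (I.2.10) versus the weight of `⟨·,·⟩_{T⁽ᵏ⁾}`.
[cite: Balaban1982Higgs1, (2.10) p.609] -/
theorem precAt_eq (a : ℝ) (k : ℕ) : precAt P a k = coeff221 P a k * P.mesh k ^ P.d := by
  rw [precAt, B1RT.prec_eq, coeff221_eq]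
  have hℓ : P.mesh k ≠ 0 := (P.mesh_pos k).ne'
  rw [zpow_sub₀ hℓ, zpow_natCast, inv_pow, mul_assoc]
  congr 1
  rw [div_eq_mul_inv, mul_comm, zpow_ofNat]

/-- `Q_k(Ã)` of a field supported on `Ω = Bᵏ(Λ_k)` VANISHES off `Λ_k` (the block `Bᵏ(y)` of `y ∉ Λ_k` misses `Ω`).
[cite: Balaban1982Higgs1, (2.11) p.609] -/
theorem avgQk_extP_of_not (j : Fin K) (v : PSite R j → V N) {y : HiggsLattice.Site P (j.val + 1)} (hy : y ∉ R.block j) :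
    avgQk C A (j.val + 1) (extP R j v) y = 0 := by
  rw [avgQk_apply]
  refine smul_eq_zero_of_right _ (Finset.sum_eq_zero fun x hx => ?_)
  rw [mem_blockK] at hx
  have hx' : ¬ inPiece R j x := by
    show ¬ (blockIter (j.val + 1) x ∈ R.block j)
    rw [hx]
    exact hy
  rw [extP_apply_of_not R j v hx', map_zero]

/-- On `Λ_k`, `Q_k(Ã)φ` sees only `φ↾_Ω`: `(Q_k(Ã)φ)(y) = (Q_k(Ã)(extP(φ↾_Ω)))(y)` for `y ∈ Λ_k`. [cite: Balaban1982Higgs1, (2.11) p.609] -/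
theorem avgQk_eq_extP_resΩ (j : Fin K) (φ : ScalarField P 0 N) {y : HiggsLattice.Site P (j.val + 1)} (hy : y ∈ R.block j) :
    avgQk C A (j.val + 1) φ y = avgQk C A (j.val + 1) (extP R j (resΩ R j φ)) y := by
  refine avgQk_congr C A (j.val + 1) y fun x hx => ?_
  rw [mem_blockK] at hx
  have hx' : inPiece R j x := by
    show blockIter (j.val + 1) x ∈ R.block j
    rw [hx]
    exact hy
  rw [extP_apply_of R j _ hx']
  rfl

/-- `⟨f, f⟩_{T⁽ᵏ⁾}` split along `Λ_k`. [folklore] [cite: Balaban1982Higgs2, (3.24) p.588] -/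
theorem siteInner_self_split_lvl (j : Fin K) (f : ScalarField P (j.val + 1) N) :
    siteInner f f = (∑ y : LSite R j, P.mesh (j.val + 1) ^ P.d * ‖f y.val‖ ^ 2)
      + ∑ y ∈ (R.block j)ᶜ, P.mesh (j.val + 1) ^ P.d * ‖f y‖ ^ 2 := by
  rw [siteInner_self_eq, ← Finset.sum_add_sum_compl (R.block j),
    ← Finset.sum_coe_sort (R.block j) (fun y => P.mesh (j.val + 1) ^ P.d * ‖f y‖ ^ 2)]

variable {a msq}

/-- **The whole-torus exponent at a field supported on the piece IS the piece exponent**: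
`wholeExp (extL ψ) (extP v) = pieceExp ψ v`. [cite: Balaban1982Higgs1, (2.19) p.610] -/
theorem wholeExp_extP (j : Fin K) (ψ : LSite R j → V N) (v : PSite R j → V N) :
    wholeExp C (pieceF R j) A msq a (j.val + 1) (extL R j ψ) (extP R j v) = pieceExp R C a A msq j ψ v := by
  unfold wholeExp pieceExp
  congr 1
  rw [siteInner_self_split_lvl R j, precAt_eq]
  have h0 : ∑ y ∈ (R.block j)ᶜ, P.mesh (j.val + 1) ^ P.d
      * ‖(extL R j ψ - avgQkLin C A (j.val + 1) (extP R j v)) y‖ ^ 2 = 0 :=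
    Finset.sum_eq_zero fun y hy => by
      have hy' : y ∉ R.block j := Finset.mem_compl.mp hy
      rw [Pi.sub_apply, avgQkLin_apply, avgQk_extP_of_not R C A j v hy']
      simp [extL, hy']
  rw [h0, add_zero, Finset.mul_sum]
  refine Finset.sum_congr rfl fun y _ => ?_
  rw [Pi.sub_apply, avgQkLin_apply]
  simp only [extL, y.prop, dif_pos]
  ring

/-- **The whole-torus exponent dominates the piece exponent of the restriction** (`m² ≥ 0`, `a_k(Lᵏε)^{−2} ≥ 0`): the sites of
`T⁽ᵏ⁾ ∖ Λ_k` and of `T_ε ∖ Ω` only add non-negative terms. [cite: Balaban1982Higgs1, (2.19) p.610] -/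
theorem pieceExp_resΩ_le (hmsq : 0 ≤ msq) (j : Fin K) (hκ : 0 ≤ coeff221 P a (j.val + 1)) (ψ : LSite R j → V N)
    (φ : ScalarField P 0 N) :
    pieceExp R C a A msq j ψ (resΩ R j φ) ≤ wholeExp C (pieceF R j) A msq a (j.val + 1) (extL R j ψ) φ := by
  unfold wholeExp pieceExp
  have hd0 : ∀ (f : ScalarField P 0 N), siteInner f (delta0 C (pieceF R j) A msq f)
      = siteInner f (covLaplacianN C (pieceF R j) A f) + msq * siteInner f f := fun f => by
    rw [← siteBilin_apply, delta0_apply, map_add, map_smul, siteBilin_apply, siteBilin_apply, smul_eq_mul]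
  -- kernel part
  have hker : (∑ y : LSite R j, precAt P a (j.val + 1) * ‖ψ y - avgQk C A (j.val + 1) (extP R j (resΩ R j φ)) y.val‖ ^ 2)
      ≤ coeff221 P a (j.val + 1) * siteInner (extL R j ψ - avgQkLin C A (j.val + 1) φ)
          (extL R j ψ - avgQkLin C A (j.val + 1) φ) := by
    rw [siteInner_self_split_lvl R j, mul_add, precAt_eq, Finset.mul_sum]
    have h1 : (∑ y : LSite R j, coeff221 P a (j.val + 1) * P.mesh (j.val + 1) ^ P.d
        * ‖ψ y - avgQk C A (j.val + 1) (extP R j (resΩ R j φ)) y.val‖ ^ 2)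
        = ∑ y : LSite R j, coeff221 P a (j.val + 1) * (P.mesh (j.val + 1) ^ P.d
          * ‖(extL R j ψ - avgQkLin C A (j.val + 1) φ) y.val‖ ^ 2) :=
      Finset.sum_congr rfl fun y _ => by
        rw [Pi.sub_apply, avgQkLin_apply, avgQk_eq_extP_resΩ R C A j φ y.prop]
        simp only [extL, y.prop, dif_pos]
        ring
    rw [h1]
    have h2 : 0 ≤ coeff221 P a (j.val + 1) * ∑ y ∈ (R.block j)ᶜ,
        P.mesh (j.val + 1) ^ P.d * ‖(extL R j ψ - avgQkLin C A (j.val + 1) φ) y‖ ^ 2 :=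
      mul_nonneg hκ (Finset.sum_nonneg fun y _ => mul_nonneg (pow_nonneg (P.mesh_pos _).le _) (sq_nonneg _))
    linarith
  -- Laplacian part (locality) and mass part
  have hlap : siteInner (extP R j (resΩ R j φ)) (covLaplacianN C (pieceF R j) A (extP R j (resΩ R j φ)))
      = siteInner φ (covLaplacianN C (pieceF R j) A φ) :=
    siteInner_covLaplacianN_congr C (pieceF R j) A fun x hx => by
      rw [extP_apply_of R j _ (by simpa using hx)]
      rfl
  have hmass : siteInner (extP R j (resΩ R j φ)) (extP R j (resΩ R j φ)) ≤ siteInner φ φ := by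
    rw [siteInner_extP_self, siteInner_self_split (inPiece R j) φ]
    have h2 : 0 ≤ ∑ x : {x // ¬ inPiece R j x}, P.mesh 0 ^ P.d * ‖φ x.val‖ ^ 2 :=
      Finset.sum_nonneg fun x _ => mul_nonneg (pow_nonneg (P.mesh_pos 0).le _) (sq_nonneg _)
    have h3 : ∑ x : PSite R j, P.mesh 0 ^ P.d * ‖resΩ R j φ x‖ ^ 2 = ∑ x : PSite R j, P.mesh 0 ^ P.d * ‖φ x.val‖ ^ 2 := rfl
    linarith
  rw [hd0, hd0, hlap]
  have := mul_le_mul_of_nonneg_left hmass hmsq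
  linarith

/-- **`termForm` = the whole-torus minimum.** [cite: Balaban1982Higgs1, (2.19) p.610] [cite: Balaban1982Higgs2, (3.28) p.589] -/
theorem termForm_eq_iInf_wholeExp (ha : 0 < a) (hL : 1 < P.L) (hmsq : 0 ≤ msq) (j : Fin K) (ψ : LSite R j → V N) :
    termForm R C a A msq j ψ = ⨅ φ : ScalarField P 0 N, wholeExp C (pieceF R j) A msq a (j.val + 1) (extL R j ψ) φ := by
  have hκ : 0 ≤ coeff221 P a (j.val + 1) := by
    rw [coeff221_eq]
    have hL' : (1 : ℝ) < P.L := by exact_mod_cast hL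
    exact mul_nonneg (B1.aSeq_pos ha hL' (Nat.le_add_left 1 _)).le (sq_nonneg _)
  have hbddW : BddBelow (Set.range fun φ : ScalarField P 0 N =>
      wholeExp C (pieceF R j) A msq a (j.val + 1) (extL R j ψ) φ) :=
    ⟨0, by
      rintro _ ⟨φ, rfl⟩
      exact le_trans (pieceExp_nonneg R C A ha hL hmsq j ψ _) (pieceExp_resΩ_le R C A hmsq j hκ ψ φ)⟩
  have hbddP : BddBelow (Set.range fun v : PSite R j → V N => pieceExp R C a A msq j ψ v) :=
    ⟨0, by rintro _ ⟨v, rfl⟩; exact pieceExp_nonneg R C A ha hL hmsq j ψ v⟩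
  refine le_antisymm (le_ciInf fun φ => ?_) (le_ciInf fun v => ?_)
  · exact le_trans (ciInf_le hbddP (resΩ R j φ)) (pieceExp_resΩ_le R C A hmsq j hκ ψ φ)
  · rw [← wholeExp_extP R C A j ψ v]
    exact ciInf_le hbddW _

/-- **`⟨φ_k, Δ^{(k),Lᵏε}(Bᵏ(Λ_k), Ã^ε)φ_k⟩` WITH THE SOLVED OPERATOR (I.2.21)**: the per-scale form of (3.28) (the fibre minimum
`termForm` of `B2Eq328ConcretePieces`, = the exponent form of the renormalization transformation by `eq219_piece`) equals the
quadratic form of the tree's `B1Eq230FluctCov.deltaKA C (Bᵏ(Λ_k)) Ã m² a k` at `φ_k` extended by zero to `T⁽ᵏ⁾`. PROVED for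
every `Ã`, `m² > 0`, `a > 0`, `L > 1`. [cite: Balaban1982Higgs1, (2.21) p.610] [cite: Balaban1982Higgs2, (3.28) p.589] -/
theorem termForm_eq_deltaKA (ha : 0 < a) (hL : 1 < P.L) (hmsq : 0 < msq) (j : Fin K) (ψ : LSite R j → V N) :
    termForm R C a A msq j ψ
      = siteInner (extL R j ψ) (deltaKA C (pieceF R j) A msq a (j.val + 1) (extL R j ψ)) := by
  have hL' : (1 : ℝ) < P.L := by exact_mod_cast hL
  rw [termForm_eq_iInf_wholeExp R C A ha hL hmsq.le j ψ]
  exact iInf_wholeExp C (pieceF R j) A j.val hmsq (B1.aSeq_pos ha hL' (Nat.le_add_left 1 _)).le (extL R j ψ)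

end Piece

/-! ## §3 (3.28) with the (I.2.21) operators -/

section Eq328

variable (R : Regions P K) (C : ChargeData N) {a : ℝ} (A : HiggsLattice.VecField P 0) {msq : ℝ}

/-- **(3.28) ON THE CONCRETE CARRIER WITH THE OPERATORS (I.2.21)**: *"⟨Φ, Δ′(Ã^ε)Φ⟩ = Σ_{k=0}^{K} ⟨φ_k,
Δ^{(k),Lᵏε}(Bᵏ(Λ₅⁽ᵏ⁻¹⁾′∩Λ₅⁽ᵏ⁾ᶜ), Ã^ε)φ_k⟩"* — the `k = 0` term `⟨φ₀, (−Δ^{ε,N}_{Ã,Λ₅⁽⁰⁾ᶜ} + m²)φ₀⟩` ((I.2.17)) plus, for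
`k = 1, …, K`, the forms of the tree's `deltaKA C (Bᵏ(Λ_k)) Ã m² a k` at `φ_k` (extended by zero). General `Ã`, `m² > 0`, under
`Nested R`. [cite: Balaban1982Higgs2, (3.28) p.589] -/
theorem eq328_deltaKA (hR : Nested R) (ha : 0 < a) (hL : 1 < P.L) (hmsq : 0 < msq) (Φ : Cfg R N) :
    form325N R C a hR.pieces A msq Φ
      = outTerm R C A msq Φ.1
        + ∑ j : Fin K, siteInner (extL R j (resL R j Φ))
            (deltaKA C (pieceF R j) A msq a (j.val + 1) (extL R j (resL R j Φ))) := by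
  rw [eq328_concrete R C A hR ha hL hmsq.le Φ]
  congr 1
  exact Finset.sum_congr rfl fun j _ => termForm_eq_deltaKA R C A ha hL hmsq j _

end Eq328

end Literature.MathematicalPhysics.QuantumFieldTheory.Balaban1983to89.B2Eq328DeltaK
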